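import Summits.CriticalPhenomena.Ising3DConformalLimit.Theorems.FKParityRobustnessStrandShadowAizenmanPairings
import Summits.CriticalPhenomena.Ising3DConformalLimit.Theorems.FKParityRobustnessStrandShadowOddCutDefs
import Summits.CriticalPhenomena.Ising3DConformalLimit.Theorems.FKParityRobustnessStrandShadowTraceDictionary
import HarnessLib

/-!
# Stub `stub_aizenmanLoopDictionary` of line `odd-cluster-cut-exact-helper` (crux `StrandShadow`, stmt-CriticalPhenomena-14626)

Route `FKParityRobustness`, sub-problem `Ising3DConformalLimit`.  Finite graph `G`, `β ≥ 0`,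
`t = tanh β`, `a : Fin 4 → V` injective, `A = {a 0, …, a 3}`, `Z_S` the sourced loop-O(1)
partition functions, `⟨σ_S⟩ = Z_S / Z_∅` (`isingCorr_univ_free_eq_loopO1_div`).

(i) **Aizenman's identity in loop-O(1) dress**:
`(G₀₁G₂₃ + G₀₂G₁₃ + G₀₃G₁₂ − ⟨σ_A⟩)·Z_∅² = 2·JJ` (`jointJoinMass`): the product form
`Z₀₁Z₂₃ + Z₀₂Z₁₃ + Z₀₃Z₁₂ = Z_A Z_∅ + 2·JJ` is `aizLoop_pairingsIdentity`
(`Theorems/FKParityRobustnessStrandShadowAizenmanPairings.lean`: random-current identity for `U₄`,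
pair switching, parity of sources per cluster, `Z[S] = cosh^{|E|} Z_S`), fed with the SAME-GRAPH
instance `G₁ := G` of the nested two-current trace dictionary `twoCurrentTraceDictionary`
(`Theorems/FKParityRobustnessStrandShadowTraceDictionary.lean`; on `G₁ = G` the support condition
is vacuous, `E₁ = E(G)` and `F′ ∩ E(G) = F′`).
(ii) **the pairing decomposition** `Z_A = C₂₃ + C₁₃ + C₁₂ + AJ` is `aizLoop_pairingPartition`
(handshake in the `a₀`-cluster).

References: M. Aizenman, Comm. Math. Phys. 86 (1982), Prop. 5.1 [AizenmanCMP1982];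
M. Aizenman, H. Duminil-Copin, Ann. of Math. 194 (2021), §3 [AizenmanDuminilCopinAnnals2021];
U. T. Hansen, J. Jiang, F. R. Klausen, arXiv:2506.10765, §2 (2.5) [HansenJiangKlausen2025].
-/

noncomputable section

open Finset SimpleGraph
open scoped ENNReal symmDiff
open Literature.Probability.LatticeModels
open Summit.CriticalPhenomena.Ising3DConformalLimit.StrandShadowNegative

namespace Summit.CriticalPhenomena.Ising3DConformalLimit.Theorems.StrandShadowOddCut

open scoped Classical

/-- The stub from the nested two-current trace dictionary (neighbour stub
`twoCurrentTraceDictionary`, statement verbatim as hypothesis): specialise it to `G₁ := G`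
(`Current.isSupp_self`, `E₁ = E(G)`, `tJoins G E(G) = tJoins G univ`, `F′ ∩ E(G) = F′`), apply
`aizLoop_pairingsIdentity` and `⟨σ_S⟩ = Z_S/Z_∅`, and `aizLoop_pairingPartition`. -/
theorem aizLoop_of_dict
    (hDict : ∀ (V : Type) [Fintype V] [DecidableEq V] (G : SimpleGraph V) [DecidableRel G.Adj]
      (G₁ : SimpleGraph V) [DecidableRel G₁.Adj] (β : ℝ), 0 ≤ β →
      ∀ (A B : Finset V) (g : Finset (Sym2 V) → ℝ≥0∞),
      (let E₁ : Finset (Sym2 V) := G.edgeFinset.filter fun e => e ∈ G₁.edgeSet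
       let t : ℝ := Real.tanh β
       ∑' p : Current G × Current G,
          (if Current.IsSupp G₁ p.1 ∧ p.1.sources = A then p.1.eweight (fun _ => β) else 0) *
            (if p.2.sources = B then p.2.eweight (fun _ => β) else 0) *
            g (E₁.filter fun e => e ∈ (p.1 + p.2).traced)
        = ENNReal.ofReal (Real.cosh β ^ (#E₁ + #G.edgeFinset)) *
          ∑ F ∈ tJoins G G₁.edgeSet A, ∑ F' ∈ tJoins G Set.univ B, ∑ η ∈ E₁.powerset,
            ENNReal.ofReal (t ^ #F * t ^ #F' * ((t ^ 2) ^ #η * (1 - t ^ 2) ^ (#E₁ - #η))) *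
              g (F ∪ F'.filter (fun e => e ∈ G₁.edgeSet) ∪ η))) :
    ∀ (V : Type) [Fintype V] [DecidableEq V] (G : SimpleGraph V) [DecidableRel G.Adj] (β : ℝ),
      0 ≤ β → ∀ a : Fin 4 → V, Function.Injective a →
      (let t : ℝ := Real.tanh β
       let Gc : Fin 4 → Fin 4 → ℝ := fun i j => isingCorr G Finset.univ β 0 .free {a i, a j}
       let C : Fin 4 → Fin 4 → ℝ := fun j k =>
         ∑ F ∈ (tJoins G Set.univ (Finset.univ.image a)).filter (fun F : Finset (Sym2 V) =>
            ¬ (SimpleGraph.fromEdgeSet (↑F : Set (Sym2 V))).Reachable (a 0) (a j) ∧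
            ¬ (SimpleGraph.fromEdgeSet (↑F : Set (Sym2 V))).Reachable (a 0) (a k)),
           t ^ F.card
       (Gc 0 1 * Gc 2 3 + Gc 0 2 * Gc 1 3 + Gc 0 3 * Gc 1 2
           - isingCorr G Finset.univ β 0 .free (Finset.univ.image a))
           * loopO1PartitionFunction G t ∅ ^ 2 = 2 * jointJoinMass G β a ∧
       loopO1PartitionFunction G t (Finset.univ.image a) = C 2 3 + C 1 3 + C 1 2 + allJoinedMass G β a) := by
  intro V _ _ G _ β hβ a ha
  -- the same-graph instance of the dictionary, clean form
  have hSelf : ∀ (A B : Finset V) (g : Finset (Sym2 V) → ℝ≥0∞),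
      ∑' p : Current G × Current G,
          (if p.1.sources = A then p.1.eweight (fun _ => β) else 0) *
            (if p.2.sources = B then p.2.eweight (fun _ => β) else 0) *
            g (G.edgeFinset.filter fun e => e ∈ (p.1 + p.2).traced)
        = ENNReal.ofReal (Real.cosh β ^ (#G.edgeFinset + #G.edgeFinset)) *
          ∑ F ∈ tJoins G Set.univ A, ∑ F' ∈ tJoins G Set.univ B, ∑ η ∈ G.edgeFinset.powerset,
            ENNReal.ofReal (Real.tanh β ^ #F * Real.tanh β ^ #F' *
              ((Real.tanh β ^ 2) ^ #η * (1 - Real.tanh β ^ 2) ^ (#G.edgeFinset - #η))) *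
              g (F ∪ F' ∪ η) := by
    intro A B g
    have h := hDict V G G β hβ A B g
    dsimp only at h
    have hE : (G.edgeFinset.filter fun e => e ∈ G.edgeSet) = G.edgeFinset :=
      Finset.filter_true_of_mem fun e he => SimpleGraph.mem_edgeFinset.1 he
    have hT : tJoins G G.edgeSet A = tJoins G Set.univ A := by
      ext F
      simp only [mem_tJoins, Set.subset_univ, true_and]
      constructor
      · rintro ⟨h1, -, h3⟩
        exact ⟨h1, h3⟩
      · rintro ⟨h1, h3⟩
        exact ⟨h1, fun e he => SimpleGraph.mem_edgeFinset.1 (h1 he), h3⟩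
    simp only [hE, hT, Current.isSupp_self, true_and] at h
    rw [h]
    congr 1
    refine Finset.sum_congr rfl fun F _ => Finset.sum_congr rfl fun F' hF' => ?_
    rw [Finset.filter_true_of_mem fun e he =>
      SimpleGraph.mem_edgeFinset.1 (((mem_tJoins G).1 hF').1 he)]
  have hI := aizLoop_pairingsIdentity V G β hβ hSelf a ha
  dsimp only at hI ⊢
  refine ⟨?_, ?_⟩
  · have hJJ : jointJoinMass G β a = ∑ F ∈ tJoins G Set.univ (Finset.univ.image a),
        ∑ F' ∈ tJoins G Set.univ ∅, ∑ η ∈ G.edgeFinset.powerset,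
          (if (∀ i j : Fin 4, (SimpleGraph.fromEdgeSet (↑(F ∪ F' ∪ η) : Set (Sym2 V))).Reachable
              (a i) (a j)) then
            Real.tanh β ^ F.card * Real.tanh β ^ F'.card *
              ((Real.tanh β ^ 2) ^ η.card * (1 - Real.tanh β ^ 2) ^ (#G.edgeFinset - η.card))
          else 0) := by
      unfold jointJoinMass etaWeight
      rfl
    have hZ0 : loopO1PartitionFunction G (Real.tanh β) ∅ ≠ 0 :=
      (loopO1PartitionFunction_empty_pos' G β).ne'
    have e1 : ∀ x y : ℝ, x / loopO1PartitionFunction G (Real.tanh β) ∅ *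
        (y / loopO1PartitionFunction G (Real.tanh β) ∅) *
        loopO1PartitionFunction G (Real.tanh β) ∅ ^ 2 = x * y := fun x y => by
      field_simp
    have e2 : ∀ x : ℝ, x / loopO1PartitionFunction G (Real.tanh β) ∅ *
        loopO1PartitionFunction G (Real.tanh β) ∅ ^ 2 = x * loopO1PartitionFunction G (Real.tanh β) ∅ :=
      fun x => by field_simp
    rw [hJJ]
    simp only [isingCorr_univ_free_eq_loopO1_div, add_mul, sub_mul, e1, e2]
    linarith [hI]
  · rw [loopO1PartitionFunction_eq_sum_tJoins]
    unfold allJoinedMass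
    exact aizLoop_pairingPartition V G (Real.tanh β) a ha

/-- **stub_aizenmanLoopDictionary** (finite graph, `β ≥ 0`, `a` injective; M).
(i) Aizenman's identity `−U₄ = 2⟨σ_A⟩·P^{A}⊗P^{∅}[A joined in n₁+n₂]` (switching lemma, pair
form, applied three times + parity of sources per cluster) in loop-O(1) dress through the EXACT
trace dictionary (`odd(n) ~ ℓ`, the even-positive edges are independent Bernoulli(`1 − sech β`),
two of them unite to Bernoulli(`tanh²β`)): `(G₀₁G₂₃ + G₀₂G₁₃ + G₀₃G₁₂ − ⟨σ_A⟩)·Z∅² = 2·JJ`.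
(ii) the induced pairing of `A` by the clusters of `F ∈ 𝒯_A` is `01|23`, `02|13`, `03|12` or
"all joined" (handshake in the `a₀`-cluster): `Z_A = C₂₃ + C₁₃ + C₁₂ + AJ`.
Refs: AizenmanCMP1982; AizenmanDuminilCopinAnnals2021 §3; HansenJiangKlausen2025 §2 (2.5). -/
theorem stub_aizenmanLoopDictionary :
    ∀ (V : Type) [Fintype V] [DecidableEq V] (G : SimpleGraph V) [DecidableRel G.Adj] (β : ℝ),
      0 ≤ β → ∀ a : Fin 4 → V, Function.Injective a →
      (let t : ℝ := Real.tanh β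
       let Gc : Fin 4 → Fin 4 → ℝ := fun i j => isingCorr G Finset.univ β 0 .free {a i, a j}
       let C : Fin 4 → Fin 4 → ℝ := fun j k =>
         ∑ F ∈ (tJoins G Set.univ (Finset.univ.image a)).filter (fun F : Finset (Sym2 V) =>
            ¬ (SimpleGraph.fromEdgeSet (↑F : Set (Sym2 V))).Reachable (a 0) (a j) ∧
            ¬ (SimpleGraph.fromEdgeSet (↑F : Set (Sym2 V))).Reachable (a 0) (a k)),
           t ^ F.card
       (Gc 0 1 * Gc 2 3 + Gc 0 2 * Gc 1 3 + Gc 0 3 * Gc 1 2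
           - isingCorr G Finset.univ β 0 .free (Finset.univ.image a))
           * loopO1PartitionFunction G t ∅ ^ 2 = 2 * jointJoinMass G β a ∧
       loopO1PartitionFunction G t (Finset.univ.image a) = C 2 3 + C 1 3 + C 1 2 + allJoinedMass G β a) :=
  aizLoop_of_dict twoCurrentTraceDictionary

end Summit.CriticalPhenomena.Ising3DConformalLimit.Theorems.StrandShadowOddCut

end
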